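import Summits.Ventures.PercRepro.S1LadderCells
import Summits.Ventures.PercRepro.S2SeriesCapSevenGen

/-!
# PercRepro — THE CELLS `(11, 5)`, `(11, 6)`, `(11, 7)` OF THE `q = 4` WINDOW (p2, gen 21; SUBCLAIM-S1 §6.5)

The three cells of the row `p = 11` that the chains alone leave open (`1.0848 / 1.0923 / 1.0988` at p8's `avgChain16`),
each by the COLOOP LADDER (S1LadderCells): a core with `c` coloops reduces to its coloop-free part on `n − c` points with the
credit `Σ_{j<c} (2^{n−1−j} − W₃⁺(n−1−j))` on the `Y`-side, and the coloop-free part takes the LAST averaging step at its own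
point count (S1Lever) — `(11, 5)`: `s₃ ≤ 6`, `s₄ ≤ 21`, `s₅ ≤ 75` on `16` points, `0.9977`; `(11, 6)`: `8 / 36 / 165` on `17`,
`0.9618`; `(11, 7)`: `11 / 48 / 324` on `18` with p7's series-class cap `s₄ ≤ 48` (S2SeriesCapSevenGen at `n = 18`), `0.9856`;
the coloop cases read `≤ 0.93`, and `c ≥ 4` coloops are the lossy ladder (`2(2^4 − 1) = 30 ≥ Φ(11, 4) = 21.16`).
Exact-rational twin mining/p2/g21/gencells.py.

* `phiK_eleven_four_le` — `Φ(11, 4) ≤ 30`; `series_cap_seven_eighteen` — p7's cap instantiated;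
* **`c025_core_eleven_five`**, **`c025_core_eleven_six`**, **`c025_core_eleven_seven`**.
Axioms: standard.
-/

open scoped Matroid

namespace PercRepro

namespace S1

open Set

variable {α : Type}

/-- `Φ(11, 4) = 28886/1365 ≤ 30`. -/
theorem phiK_eleven_four_le : phiK 11 4 ≤ 2 * ((2 : ℚ) ^ 4 - 1) := by
  simp only [phiK]
  rw [show Finset.Ioo 4 11 = {5, 6, 7, 8, 9, 10} by decide]
  norm_num [Finset.sum_insert, Finset.sum_singleton, Finset.sum_div, Nat.choose]

/-- **p7's series-class cap at `n = 18`**: a coloop-free `e`-free core of nullity `7` on `18` points has `s₄ ≤ 48`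
(S2SeriesCapSevenGen with `hB5 := avgChain16 5 = 28`). -/
theorem series_cap_seven_eighteen : ∀ (N : Matroid α) [N.Finite],
    (∀ e ∈ N.E, ∃ A ⊆ N.E \ {e}, e ∉ N.closure A ∧ e ∉ N.closure ((N.E \ {e}) \ A)) →
    N.E.encard = N.eRank + ((7 : ℕ) : ℕ∞) → N.E.ncard = 11 + 7 → N.coloops = ∅ →
    {C : Set α | N.IsCircuit C ∧ C.ncard = 4}.ncard ≤ 48 := by
  intro N _ hfree hd hn hcol
  have hd' : N.E.encard = N.eRank + 7 := by exact_mod_cast hd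
  have h := S2.ncard_fourCircuits_le_of_seven_free_of_card N hfree hd' (n := 18) hn (by norm_num) hcol
    (fun M' _ hfree' hd5 => by
      have h := ThmN.ncard_fourCircuits_le_avgChain16 5 M' hfree' (by exact_mod_cast hd5)
      rwa [show ThmN.avgChain16 5 = 28 by decide] at h)
  exact (S2.ncard_fourCircuits_le_of_seven_free_of_card_examples _).2.2 h

/-- **THE CELL `(11, 5)`**: an `e`-free core of rank `11` with `16` points satisfies `RLS` at level `4` — by the
coloop ladder: `c = 0 … 3` coloops by the exact ladder on the lever caps, `c ≥ 4` by the lossy ladder. -/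
theorem c025_core_eleven_five (M : Matroid α) [M.Finite] (hR : M.eRank = (11 : ℕ)) (hn : M.E.ncard = 16)
    (hfree : ∀ e ∈ M.E, ∃ A ⊆ M.E \ {e}, e ∉ M.closure A ∧ e ∉ M.closure ((M.E \ {e}) \ A)) :
    ThmN.RLS M 11 4 := by
  rcases (show M.coloops.ncard = 0 ∨ M.coloops.ncard = 1 ∨ M.coloops.ncard = 2 ∨ M.coloops.ncard = 3 ∨ 4 ≤ M.coloops.ncard by omega) with h | h | h | h | h
  · exact rls_of_ladder_case M (p := 11) (c := 0) (d := 5) (by norm_num) (by norm_num) hR hn hfree h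
      (by norm_num) (by norm_num) (P := 6) (S := 21) (S5 := 75) (by decide) (by decide) (by decide)
      (by decide +kernel)
  · exact rls_of_ladder_case M (p := 10) (c := 1) (d := 5) (by norm_num) (by norm_num) hR hn hfree h
      (by norm_num) (by norm_num) (P := 6) (S := 21) (S5 := 78) (by decide) (by decide) (by decide)
      (by decide +kernel)
  · exact rls_of_ladder_case M (p := 9) (c := 2) (d := 5) (by norm_num) (by norm_num) hR hn hfree h
      (by norm_num) (by norm_num) (P := 6) (S := 22) (S5 := 80) (by decide) (by decide) (by decide)
      (by decide +kernel)
  · exact rls_of_ladder_case M (p := 8) (c := 3) (d := 5) (by norm_num) (by norm_num) hR hn hfree h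
      (by norm_num) (by norm_num) (P := 6) (S := 23) (S5 := 84) (by decide) (by decide) (by decide)
      (by decide +kernel)
  · exact rls_of_coloops_lossy M (p := 7) (c := 4) (hR.trans (by norm_num)) (by norm_num) h phiK_eleven_four_le

/-- **THE CELL `(11, 6)`**: an `e`-free core of rank `11` with `17` points satisfies `RLS` at level `4` — by the
coloop ladder: `c = 0 … 3` coloops by the exact ladder on the lever caps, `c ≥ 4` by the lossy ladder. -/
theorem c025_core_eleven_six (M : Matroid α) [M.Finite] (hR : M.eRank = (11 : ℕ)) (hn : M.E.ncard = 17)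
    (hfree : ∀ e ∈ M.E, ∃ A ⊆ M.E \ {e}, e ∉ M.closure A ∧ e ∉ M.closure ((M.E \ {e}) \ A)) :
    ThmN.RLS M 11 4 := by
  rcases (show M.coloops.ncard = 0 ∨ M.coloops.ncard = 1 ∨ M.coloops.ncard = 2 ∨ M.coloops.ncard = 3 ∨ 4 ≤ M.coloops.ncard by omega) with h | h | h | h | h
  · exact rls_of_ladder_case M (p := 11) (c := 0) (d := 6) (by norm_num) (by norm_num) hR hn hfree h
      (by norm_num) (by norm_num) (P := 8) (S := 36) (S5 := 165) (by decide) (by decide) (by decide)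
      (by decide +kernel)
  · exact rls_of_ladder_case M (p := 10) (c := 1) (d := 6) (by norm_num) (by norm_num) hR hn hfree h
      (by norm_num) (by norm_num) (P := 8) (S := 37) (S5 := 170) (by decide) (by decide) (by decide)
      (by decide +kernel)
  · exact rls_of_ladder_case M (p := 9) (c := 2) (d := 6) (by norm_num) (by norm_num) hR hn hfree h
      (by norm_num) (by norm_num) (P := 8) (S := 38) (S5 := 175) (by decide) (by decide) (by decide)
      (by decide +kernel)
  · exact rls_of_ladder_case M (p := 8) (c := 3) (d := 6) (by norm_num) (by norm_num) hR hn hfree h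
      (by norm_num) (by norm_num) (P := 8) (S := 39) (S5 := 182) (by decide) (by decide) (by decide)
      (by decide +kernel)
  · exact rls_of_coloops_lossy M (p := 7) (c := 4) (hR.trans (by norm_num)) (by norm_num) h phiK_eleven_four_le

/-- **THE CELL `(11, 7)`**: an `e`-free core of rank `11` with `18` points satisfies `RLS` at level `4` — by the
coloop ladder: `c = 0 … 3` coloops by the exact ladder on the lever caps, `c ≥ 4` by the lossy ladder. -/
theorem c025_core_eleven_seven (M : Matroid α) [M.Finite] (hR : M.eRank = (11 : ℕ)) (hn : M.E.ncard = 18)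
    (hfree : ∀ e ∈ M.E, ∃ A ⊆ M.E \ {e}, e ∉ M.closure A ∧ e ∉ M.closure ((M.E \ {e}) \ A)) :
    ThmN.RLS M 11 4 := by
  rcases (show M.coloops.ncard = 0 ∨ M.coloops.ncard = 1 ∨ M.coloops.ncard = 2 ∨ M.coloops.ncard = 3 ∨ 4 ≤ M.coloops.ncard by omega) with h | h | h | h | h
  · exact rls_of_ladder_case_cap M (p := 11) (c := 0) (d := 7) (by norm_num) (by norm_num) hR hn hfree h
      (by norm_num) (by norm_num) (P := 11) (S := 48) (S5 := 324) (by decide) series_cap_seven_eighteen (by decide)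
      (by decide +kernel)
  · exact rls_of_ladder_case M (p := 10) (c := 1) (d := 7) (by norm_num) (by norm_num) hR hn hfree h
      (by norm_num) (by norm_num) (P := 11) (S := 60) (S5 := 331) (by decide) (by decide) (by decide)
      (by decide +kernel)
  · exact rls_of_ladder_case M (p := 9) (c := 2) (d := 7) (by norm_num) (by norm_num) hR hn hfree h
      (by norm_num) (by norm_num) (P := 11) (S := 61) (S5 := 340) (by decide) (by decide) (by decide)
      (by decide +kernel)
  · exact rls_of_ladder_case M (p := 8) (c := 3) (d := 7) (by norm_num) (by norm_num) hR hn hfree h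
      (by norm_num) (by norm_num) (P := 11) (S := 62) (S5 := 351) (by decide) (by decide) (by decide)
      (by decide +kernel)
  · exact rls_of_coloops_lossy M (p := 7) (c := 4) (hR.trans (by norm_num)) (by norm_num) h phiK_eleven_four_le

end S1

end PercRepro
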